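import Literature.NumberTheory.Automorphic.UnitaryGroupSymplecticEmbedding
import Literature.NumberTheory.Automorphic.UnitaryGroupRestrictedProduct
import Literature.NumberTheory.Automorphic.UnitaryGroupArchimedeanPlaces
import Literature.NumberTheory.Automorphic.ClassFieldCharacter
import HarnessLib

/-!
# The unitary dual pair in the symplectic group over a quadratic extension of number fields:
`U(J)(F) ⊂ Sp_{2N}(F)`, `U(J)(F_v) ⊂ Sp_{2N}(F_v)`, `U(J)(𝔸_F^∞) ⊂ Sp_{2N}(𝔸_F^∞)`, `U(J)(𝔸_F) ⊂ Sp_{2N}(𝔸_F)`,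
`U(J)(ℝ) ⊂ Sp_{2N}(ℝ)`
(Gelbart–Rogawski 1991 §3.1: `W = Res_{E/F} V`, `G = U(V) ⊂ Sp(W)`; Mœglin–Vignéras–Waldspurger Ch. 1 I.17–I.19)

Topic `NumberTheory/Automorphic`; namespace `Literature.NumberTheory.Automorphic.UnitaryGroup` (second part of
`UnitaryGroupSymplecticEmbedding`). Definitions and proved lemmas only: **no named facts, 0 proof holes**.

**Setting.** `E/F` a quadratic extension of number fields, `c ∈ Aut(E/F)`, `δ ∈ E` with `c δ = -δ ≠ 0`, `δ² = d ∈ F`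
(`exists_algEquiv_apply_eq_neg`, `exists_mul_self_eq_algebraMap`), and an `F`-RATIONAL SYMMETRIC Gram matrix
`T ∈ Sym_N(F)` with hermitian form matrix `J = T.map (algebraMap F E)` (hypothesis `hJ : J = T ⊗ 1`, so that any
definitionally different spelling of the tree's form matrices can be fed in; a general hermitian `J` is moved to a
diagonal `F`-rational one by `UnitaryGroupFormTransport.unitaryGroupOfFormCongr`). The generic theorem
`IsQuadraticCoordinates.toSymplectic` of `UnitaryGroupSymplecticEmbedding` is instantiated on the tree's carriers:

* §1 `E = F ⊕ F δ`: `quadraticBasis`, `quadraticRatCoords : F × F ≃ E`, `isQuadraticCoordinates_rat`; the rational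
  points **`rationalToSymplectic : U(J)(F) = rational F E c N J →* Sp(F^N × F^N, alt (polar β_T))`** — Gelbart–Rogawski's
  `i(Sp_F(W)) ⊃ s(G(F))` lives here.
* §2 finite places: the form `J ⊗ 1 ∈ M_N(E ⊗ F_v)` is `(T ⊗ 1) ⊗ 1` (`localForm_eq_map`); **`localToSymplectic v :
  U(J)(F_v) = «local» E c N J v →* Sp(F_v^N × F_v^N, alt (polar β_T))`** and `localPiToSymplectic v` on the factor form
  `localPi`; injective.
* §3 finite adeles: `conjFiniteAdele` fixes `𝔸_F^∞ ⊗ 1` (`conjFiniteAdele_baseChange`); **`finAdelicToSymplectic :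
  U(J)(𝔸_F^∞) = finAdelic F E c N J →* Sp((𝔸_F^∞)^N × (𝔸_F^∞)^N, alt (polar β_T))`**; injective.
* §3b adeles (`AdeleRing.smul_baseChange` of `ClassFieldCharacter`): **`adelicToSymplectic :
  U(J)(𝔸_F) = adelic F E c N J →* Sp(𝔸_Fᴺ × 𝔸_Fᴺ, alt (polar β_T))`** = Gelbart–Rogawski's `G(𝐀) ⊂ Sp_𝐀(W)`; injective.
* §4 a complex place `w` of `E` fixed by `c ≠ 1` (so `σ_w ∘ c = conj ∘ σ_w`, `UnitaryGroupArchimedeanPlaces`):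
  `ℂ = ℝ ⊕ ℝ σ_w(δ)` (`complexCoords`, `isQuadraticCoordinates_complex`), the real Gram matrix `T_w = σ_w(T)`
  (`realPlaceMap`), and **`archLocalToSymplectic w : U(σ_w J)(ℂ)_ℝ = archLocal E N J w →* Sp(ℝ^N × ℝ^N, alt (polar β_{T_w}))`**;
  injective.
* §5 the dual pair at each level: `U(J_V) × U(J_W) →* Sp` for two `F`-rational Gram matrices `T_V ∈ Sym_N(F)`,
  `T_W ∈ Sym_M(F)` (`rationalDualPairToSymplectic`, `localDualPairToSymplectic`, `finAdelicDualPairToSymplectic`,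
  `adelicDualPairToSymplectic`, `archLocalDualPairToSymplectic`), with commuting images (from
  `dualPairToSymplectic_commute`);
* §6 rational points go to rational points: `re_𝔸 (e ⊗ 1) = re_F(e) ⊗ 1` (`adele_re_algebraMap`, `…_im_…`, finite-adelic
  versions) and the block formula `adelicToSymplectic_toAdelic_apply` — `ι_𝔸(G(F))` has `F`-rational blocks
  (Gelbart–Rogawski's `s(G(F)) ⊂ i(Sp_F(W))` is a statement about these points).
* §7 Darboux transport: `symplecticGroupCongr` (an isometry `θ` conjugates `Sp(alt B)` into `Sp(alt B′)`), the Darboux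
  map `darboux T : (a, b) ↦ (a, T b)` with `polar β_dot ∘ θ_T = polar β_T` (`polar_dot_darboux`), the generic
  `IsQuadraticCoordinates.toSymplecticDot : U(σ,H) →* Sp(alt (polar β_dot))` and the archimedean instance
  `archLocalToSymplecticDot : U(J)(E_w) →* symplecticGroup (polar (dotProductBilin ℝ ℝ))` = the `SpR (Fin N)` of
  `Weil1964/ArchWeilDatum.lean`.

In each case the symplectic space is the `R`-rational complete polarisation `X ⊕ Y = Rᴺ · 1 ⊕ Rᴺ · δ` of
`Res (E ⊗_F R)ᴺ` with `⟪(a, b), (a', b')⟫ = aᵀ T b' - a'ᵀ T b = im h` (`im_hermForm_map`), `X`, `Y` Lagrangian, and the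
map is `g ↦ (x ↦ g x)` in these coordinates (`toSymplectic_reIm`); this is the group-side input `ι : G → Sp(𝕎)` over
which the Schrödinger-model / Weil-representation files of the tree (`HeisenbergGroup/*`, `Weil1964/*`) are
parametrised.

## Mathlib / tree

Mathlib: `basisOfLinearIndependentOfCardEqFinrank`, `Basis.equivFun`, `LinearEquiv.finTwoArrow`,
`Algebra.IsQuadraticExtension.finrank_eq_two`, `Complex.ext`, `Complex.conj_eq_iff_im`, `FiniteAdeleRing.ext`.
Tree: `UnitaryGroupSymplecticEmbedding` (`toSymplectic`, `dualPairToSymplectic`), `QuadraticRestrictionOfScalars`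
(`isQuadraticCoordinates_local`, `isQuadraticCoordinates_finiteAdele`), `QuadraticLocalBaseChange` (`toLocalRing_coe`,
`conjLocal_toLocalRing`, `conjLocal_algebraMap`, `not_mem_range_algebraMap_of_apply_eq_neg`), `QuadraticAdeleBaseChange`
(`finiteAdeleToLocal`, `finiteAdeleToLocal_baseChange`), `QuadraticRestrictionOfScalars` (`isQuadraticCoordinates_adele`),
`ClassFieldCharacter` (`AdeleRing.smul_baseChange`), `UnitaryGroupAutomorphicRep` (`rational`, `«local»`, `adelic`,
`adelicForm`, `adeleToLocal`, `conjAdele`, `algebraMap_conj`), `UnitaryGroupLocalFactors` (`localPi`, `localPiEquiv`), `UnitaryGroupRestrictedProduct`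
(`finAdelic`, `finiteAdelicForm`, `conjFiniteAdele`), `UnitaryGroupArchimedeanPlaces` (`archLocal`, `embedding_galConj`).

## Provenance

Written under the LEAN-IN-TREE rule (2026-08-18) for the pub-hodgecm formalisation cell (model-construction sub-cell,
node W2-ι). Nothing in this file is a claim of the manuscripts adjudicated by that cell; every property is proved in
the kernel.

## References

* S. Gelbart, J. Rogawski, L-functions and Fourier–Jacobi coefficients for the unitary group U(3), Invent. Math. 105
  (1991), §3.1 [GelbartRogawski1991].
* C. Mœglin, M.-F. Vignéras, J.-L. Waldspurger, *Correspondances de Howe sur un corps p-adique*, LNM 1291 (1987),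
  Ch. 1 [MoeglinVignerasWaldspurger1987].
-/

noncomputable section

open Matrix NumberField IsDedekindDomain
open scoped Kronecker
open Literature.RepresentationTheory.HeisenbergGroup

namespace Literature.NumberTheory.Automorphic

namespace UnitaryGroup

variable {F : Type} (E : Type) [Field F] [NumberField F] [Field E] [NumberField E] [Algebra F E]

/-! ## 1. `E = F ⊕ F δ` and the rational points `U(J)(F) → Sp_{2N}(F)` -/

section Rational

/-- `(1, δ)` is linearly independent over `F` when `δ ∉ F`. [folklore] -/
theorem linearIndependent_one_delta {δ : E} (hδF : δ ∉ Set.range (algebraMap F E)) :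
    LinearIndependent F ![(1 : E), δ] := by
  refine LinearIndependent.pair_iff.mpr fun s t hst => ?_
  by_cases ht : t = 0
  · subst ht
    simp only [zero_smul, add_zero, smul_eq_zero, one_ne_zero, or_false] at hst
    exact ⟨hst, rfl⟩
  · exfalso
    apply hδF
    refine ⟨-(s / t), ?_⟩
    have hst' : algebraMap F E s + algebraMap F E t * δ = 0 := by
      simpa only [Algebra.smul_def, mul_one] using hst
    have htE : algebraMap F E t ≠ 0 := (map_ne_zero _).mpr ht
    rw [map_neg, map_div₀, neg_eq_iff_eq_neg, div_eq_iff htE]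
    linear_combination hst'

/-- **The basis `(1, δ)` of a quadratic extension `E/F`** (`δ ∉ F`). [folklore] -/
def quadraticBasis [Algebra.IsQuadraticExtension F E] {δ : E} (hδF : δ ∉ Set.range (algebraMap F E)) :
    Module.Basis (Fin 2) F E :=
  haveI : FiniteDimensional F E :=
    Module.finite_of_finrank_eq_succ (Algebra.IsQuadraticExtension.finrank_eq_two F E)
  basisOfLinearIndependentOfCardEqFinrank (linearIndependent_one_delta E hδF)
    (by rw [Fintype.card_fin, Algebra.IsQuadraticExtension.finrank_eq_two])

/-- `quadraticBasis 0 = 1`, `quadraticBasis 1 = δ`. [folklore] -/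
@[simp] theorem coe_quadraticBasis [Algebra.IsQuadraticExtension F E] {δ : E} (hδF : δ ∉ Set.range (algebraMap F E)) :
    ⇑(quadraticBasis E hδF) = ![(1 : E), δ] :=
  coe_basisOfLinearIndependentOfCardEqFinrank _ _

/-- **`F × F ≃ E`, `(a, b) ↦ a + b δ`**: the coordinates of `E = F ⊕ F δ`. [folklore] -/
def quadraticRatCoords [Algebra.IsQuadraticExtension F E] {δ : E} (hδF : δ ∉ Set.range (algebraMap F E)) :
    (F × F) ≃ₗ[F] E :=
  ((quadraticBasis E hδF).equivFun.trans (LinearEquiv.finTwoArrow F F)).symm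

/-- `quadraticRatCoords (a, b) = a + b δ`. [folklore] -/
@[simp] theorem quadraticRatCoords_apply [Algebra.IsQuadraticExtension F E] {δ : E}
    (hδF : δ ∉ Set.range (algebraMap F E)) (p : F × F) :
    quadraticRatCoords E hδF p = algebraMap F E p.1 + algebraMap F E p.2 * δ := by
  simp only [quadraticRatCoords, LinearEquiv.symm_trans_apply, LinearEquiv.finTwoArrow,
    Module.Basis.equivFun_symm_apply,
    Fin.sum_univ_two, coe_quadraticBasis, Matrix.cons_val_zero, Matrix.cons_val_one, Algebra.smul_def,
    mul_one]
  rfl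

/-- **`E = F ⊕ F δ` as quadratic coordinates** (`φ = algebraMap F E`, `Ψ = quadraticRatCoords`). [folklore] -/
theorem isQuadraticCoordinates_rat [Algebra.IsQuadraticExtension F E] (c : E ≃ₐ[F] E) {δ : E} (hcδ : c δ = -δ)
    (hδ : δ ≠ 0) {d : F} (hd : δ * δ = algebraMap F E d) :
    IsQuadraticCoordinates (algebraMap F E)
      (quadraticRatCoords E (not_mem_range_algebraMap_of_apply_eq_neg E c hcδ hδ)).toAddEquiv δ d where
  apply a b := quadraticRatCoords_apply E _ (a, b)
  mul_self := hd

variable (F) (c : E ≃ₐ[F] E) (N : ℕ)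

/-- **`U(J)(F) →* Sp(Fᴺ × Fᴺ, alt (polar β_T))`** for `J = T ⊗ 1`, `T ∈ Sym_N(F)`: the rational points of the unitary
group in the rational points of the symplectic group of `W = Res_{E/F} Eᴺ` (Gelbart–Rogawski: `s(G(F)) ⊂ i(Sp_F(W))`
is about this subgroup). [cite: GelbartRogawski1991, §3.1 p. 454] -/
def rationalToSymplectic [Algebra.IsQuadraticExtension F E] {δ : E} (hcδ : c δ = -δ) (hδ : δ ≠ 0) {d : F}
    (hd : δ * δ = algebraMap F E d) {T : Matrix (Fin N) (Fin N) F} (hT : T.IsSymm) {J : Matrix (Fin N) (Fin N) E}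
    (hJ : J = T.map (algebraMap F E)) :
    rational F E c N J →* symplecticGroup (polar (Matrix.toLinearMap₂' F T)) :=
  (isQuadraticCoordinates_rat E c hcδ hδ hd).toSymplectic (Fin N) hT (σ := (c : E →+* E))
    (fun a => c.commutes a) hcδ hJ

/-- `rationalToSymplectic g (reIm x) = reIm (g x)` on `Eᴺ`. [folklore] -/
theorem rationalToSymplectic_reIm [Algebra.IsQuadraticExtension F E] {δ : E} (hcδ : c δ = -δ) (hδ : δ ≠ 0) {d : F}
    (hd : δ * δ = algebraMap F E d) {T : Matrix (Fin N) (Fin N) F} (hT : T.IsSymm) {J : Matrix (Fin N) (Fin N) E}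
    (hJ : J = T.map (algebraMap F E)) (g : rational F E c N J) (x : Fin N → E) :
    (rationalToSymplectic F E c N hcδ hδ hd hT hJ g).1
        (QuadraticCoordinates.reIm
          (quadraticRatCoords E (not_mem_range_algebraMap_of_apply_eq_neg E c hcδ hδ)).toAddEquiv (Fin N) x) =
      QuadraticCoordinates.reIm
        (quadraticRatCoords E (not_mem_range_algebraMap_of_apply_eq_neg E c hcδ hδ)).toAddEquiv (Fin N)
        ((g : GL (Fin N) E) *ᵥ x) :=
  (isQuadraticCoordinates_rat E c hcδ hδ hd).toSymplectic_reIm (Fin N) hT _ hcδ hJ g x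

/-- `U(J)(F) → Sp_{2N}(F)` is injective. [folklore] -/
theorem rationalToSymplectic_injective [Algebra.IsQuadraticExtension F E] {δ : E} (hcδ : c δ = -δ) (hδ : δ ≠ 0)
    {d : F} (hd : δ * δ = algebraMap F E d) {T : Matrix (Fin N) (Fin N) F} (hT : T.IsSymm)
    {J : Matrix (Fin N) (Fin N) E} (hJ : J = T.map (algebraMap F E)) :
    Function.Injective (rationalToSymplectic F E c N hcδ hδ hd hT hJ) :=
  (isQuadraticCoordinates_rat E c hcδ hδ hd).toSymplectic_injective (Fin N) hT _ hcδ hJ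

end Rational

/-! ## 2. Finite places: `U(J)(F_v) → Sp_{2N}(F_v)` -/

section Local

variable (c : E ≃ₐ[F] E) (N : ℕ)

omit [NumberField F] in
/-- `𝔸_E → ∏_{w ∣ v} E_w` on principal adeles is `E → ∏ E_w` (definitional). [folklore] -/
theorem adeleToLocal_algebraMap (v : HeightOneSpectrum (𝓞 F)) (e : E) :
    adeleToLocal E v (algebraMap E (AdeleRing (𝓞 E) E) e) = algebraMap E (LocalRing E v) e := rfl

/-- **The local form matrix of `J = T ⊗ 1` is `(T ⊗ 1) ⊗ 1`**: `(J ⊗ 1 ∈ M_N(𝔸_E))_v = ι_v(T) ∈ M_N(E ⊗_F F_v)`.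
[folklore] -/
theorem localForm_eq_map (v : HeightOneSpectrum (𝓞 F)) (T : Matrix (Fin N) (Fin N) F) {J : Matrix (Fin N) (Fin N) E}
    (hJ : J = T.map (algebraMap F E)) :
    (adelicForm E N J).map (adeleToLocal E v) =
      (T.map (algebraMap F (v.adicCompletion F))).map (toLocalRing E v) := by
  rw [adelicForm, hJ, Matrix.map_map, Matrix.map_map, Matrix.map_map]
  congr 1
  funext t
  simp only [Function.comp_apply]
  exact (toLocalRing_coe E v t).symm

/-- **`U(J)(F_v) →* Sp(F_vᴺ × F_vᴺ, alt (polar β_T))`** (`v` finite) for `J = T ⊗ 1`, `T ∈ Sym_N(F)`: the local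
unitary group in the local symplectic group of `Res_{E/F} Eᴺ ⊗ F_v = (E ⊗_F F_v)ᴺ`, in the `F`-rational polarisation
`F_vᴺ · 1 ⊕ F_vᴺ · δ`. [cite: MoeglinVignerasWaldspurger1987, Ch. 1 I.17] -/
def localToSymplectic [Algebra.IsQuadraticExtension F E] (v : HeightOneSpectrum (𝓞 F)) {δ : E} (hcδ : c δ = -δ)
    (hδ : δ ≠ 0) {d : F} (hd : δ * δ = algebraMap F E d) {T : Matrix (Fin N) (Fin N) F} (hT : T.IsSymm)
    {J : Matrix (Fin N) (Fin N) E} (hJ : J = T.map (algebraMap F E)) :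
    «local» E c N J v →*
      symplecticGroup (polar (Matrix.toLinearMap₂' (v.adicCompletion F) (T.map (algebraMap F (v.adicCompletion F))))) :=
  (isQuadraticCoordinates_local E v c hcδ hδ hd).toSymplectic (Fin N) (hT.map _) (σ := conjLocal E c v)
    (conjLocal_toLocalRing c v) (by rw [conjLocal_algebraMap, hcδ, map_neg]) (localForm_eq_map E N v T hJ)

/-- `localToSymplectic g (reIm x) = reIm (g x)` on `(E ⊗_F F_v)ᴺ`. [folklore] -/
theorem localToSymplectic_reIm [Algebra.IsQuadraticExtension F E] (v : HeightOneSpectrum (𝓞 F)) {δ : E}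
    (hcδ : c δ = -δ) (hδ : δ ≠ 0) {d : F} (hd : δ * δ = algebraMap F E d) {T : Matrix (Fin N) (Fin N) F}
    (hT : T.IsSymm) {J : Matrix (Fin N) (Fin N) E} (hJ : J = T.map (algebraMap F E)) (g : «local» E c N J v)
    (x : Fin N → LocalRing E v) :
    (localToSymplectic E c N v hcδ hδ hd hT hJ g).1
        (QuadraticCoordinates.reIm (quadraticLocalEquiv E v c hcδ hδ).toLinearEquiv.toAddEquiv (Fin N) x) =
      QuadraticCoordinates.reIm (quadraticLocalEquiv E v c hcδ hδ).toLinearEquiv.toAddEquiv (Fin N)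
        ((g : GL (Fin N) (LocalRing E v)) *ᵥ x) :=
  (isQuadraticCoordinates_local E v c hcδ hδ hd).toSymplectic_reIm (Fin N) _ _ _ _ g x

/-- `U(J)(F_v) → Sp_{2N}(F_v)` is injective. [folklore] -/
theorem localToSymplectic_injective [Algebra.IsQuadraticExtension F E] (v : HeightOneSpectrum (𝓞 F)) {δ : E}
    (hcδ : c δ = -δ) (hδ : δ ≠ 0) {d : F} (hd : δ * δ = algebraMap F E d) {T : Matrix (Fin N) (Fin N) F}
    (hT : T.IsSymm) {J : Matrix (Fin N) (Fin N) E} (hJ : J = T.map (algebraMap F E)) :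
    Function.Injective (localToSymplectic E c N v hcδ hδ hd hT hJ) :=
  (isQuadraticCoordinates_local E v c hcδ hδ hd).toSymplectic_injective (Fin N) _ _ _ _

/-- **`U(J)(F_v) ≤ Π_{w ∣ v} GL_N(E_w) → Sp_{2N}(F_v)`** on the factor form `localPi` (through `localPiEquiv`).
[folklore] -/
def localPiToSymplectic [Algebra.IsQuadraticExtension F E] (v : HeightOneSpectrum (𝓞 F)) {δ : E} (hcδ : c δ = -δ)
    (hδ : δ ≠ 0) {d : F} (hd : δ * δ = algebraMap F E d) {T : Matrix (Fin N) (Fin N) F} (hT : T.IsSymm)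
    {J : Matrix (Fin N) (Fin N) E} (hJ : J = T.map (algebraMap F E)) :
    localPi E c N J v →*
      symplecticGroup (polar (Matrix.toLinearMap₂' (v.adicCompletion F) (T.map (algebraMap F (v.adicCompletion F))))) :=
  (localToSymplectic E c N v hcδ hδ hd hT hJ).comp (localPiEquiv E c N J v).toMonoidHom

/-- `localPi → Sp_{2N}(F_v)` is injective. [folklore] -/
theorem localPiToSymplectic_injective [Algebra.IsQuadraticExtension F E] (v : HeightOneSpectrum (𝓞 F)) {δ : E}
    (hcδ : c δ = -δ) (hδ : δ ≠ 0) {d : F} (hd : δ * δ = algebraMap F E d) {T : Matrix (Fin N) (Fin N) F}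
    (hT : T.IsSymm) {J : Matrix (Fin N) (Fin N) E} (hJ : J = T.map (algebraMap F E)) :
    Function.Injective (localPiToSymplectic E c N v hcδ hδ hd hT hJ) :=
  (localToSymplectic_injective E c N v hcδ hδ hd hT hJ).comp (localPiEquiv E c N J v).injective

end Local

/-! ## 3. Finite adeles: `U(J)(𝔸_F^∞) → Sp_{2N}(𝔸_F^∞)` -/

section FiniteAdele

variable (c : E ≃ₐ[F] E) (N : ℕ)

/-- `𝔸_E^∞ → ∏_{w ∣ v} E_w` intertwines `c ⊗ 1` with the local conjugation (definitional). [folklore] -/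
theorem finiteAdeleToLocal_conj (v : HeightOneSpectrum (𝓞 F)) (x : FiniteAdeleRing (𝓞 E) E) :
    finiteAdeleToLocal E v (conjFiniteAdele F E c x) = conjLocal E c v (finiteAdeleToLocal E v x) := by
  funext w
  rfl

variable {E c} in
omit [NumberField F] in
/-- `(c x) ⊗ 1 = (c ⊗ 1)(x ⊗ 1)` in `𝔸_E^∞` (`FiniteAdeleRing.smul_algebraMap`; also in `UnitaryGroupArithmeticLevels`).
[folklore] -/
theorem algebraMap_galConj_finiteAdele' (x : E) :
    algebraMap E (FiniteAdeleRing (𝓞 E) E) (c x) =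
      conjFiniteAdele F E c (algebraMap E (FiniteAdeleRing (𝓞 E) E) x) := by
  rw [conjFiniteAdele_apply, FiniteAdeleRing.smul_algebraMap]
  rfl

/-- **`c ⊗ 1` fixes `𝔸_F^∞ ⊗ 1 ⊂ 𝔸_E^∞`** (checked above each finite place of `F` through `conjLocal_toLocalRing`).
[folklore] -/
theorem conjFiniteAdele_baseChange (a : FiniteAdeleRing (𝓞 F) F) :
    conjFiniteAdele F E c (FiniteAdeleRing.baseChange (𝓞 F) F E (𝓞 E) a) =
      FiniteAdeleRing.baseChange (𝓞 F) F E (𝓞 E) a := by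
  refine FiniteAdeleRing.ext E fun w => ?_
  have key : ∀ y : FiniteAdeleRing (𝓞 E) E,
      y w = finiteAdeleToLocal E (w.under (𝓞 F)) y ⟨w, rfl⟩ := fun y => rfl
  rw [key, key, finiteAdeleToLocal_conj, finiteAdeleToLocal_baseChange, conjLocal_toLocalRing]

/-- **The finite-adelic form matrix of `J = T ⊗ 1` is `(T ⊗ 1) ⊗ 1`**. [folklore] -/
theorem finiteAdelicForm_eq_map (T : Matrix (Fin N) (Fin N) F) {J : Matrix (Fin N) (Fin N) E}
    (hJ : J = T.map (algebraMap F E)) :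
    finiteAdelicForm E N J =
      (T.map (algebraMap F (FiniteAdeleRing (𝓞 F) F))).map (FiniteAdeleRing.baseChange (𝓞 F) F E (𝓞 E)) := by
  rw [finiteAdelicForm, hJ, Matrix.map_map, Matrix.map_map]
  congr 1
  funext t
  simp only [Function.comp_apply, FiniteAdeleRing.baseChange_algebraMap]

variable (F)

/-- **`U(J)(𝔸_F^∞) →* Sp((𝔸_F^∞)ᴺ × (𝔸_F^∞)ᴺ, alt (polar β_T))`** for `J = T ⊗ 1`, `T ∈ Sym_N(F)`: the finite-adelic
unitary group in the finite-adelic symplectic group of `Res_{E/F} Eᴺ`, in the `F`-rational polarisation.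
[cite: GelbartRogawski1991, §3.1 p. 454] -/
def finAdelicToSymplectic [Algebra.IsQuadraticExtension F E] {δ : E} (hcδ : c δ = -δ) (hδ : δ ≠ 0) {d : F}
    (hd : δ * δ = algebraMap F E d) {T : Matrix (Fin N) (Fin N) F} (hT : T.IsSymm) {J : Matrix (Fin N) (Fin N) E}
    (hJ : J = T.map (algebraMap F E)) :
    finAdelic F E c N J →*
      symplecticGroup (polar (Matrix.toLinearMap₂' (FiniteAdeleRing (𝓞 F) F)
        (T.map (algebraMap F (FiniteAdeleRing (𝓞 F) F))))) :=
  (isQuadraticCoordinates_finiteAdele E c hcδ hδ hd).toSymplectic (Fin N) (hT.map _) (σ := conjFiniteAdele F E c)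
    (conjFiniteAdele_baseChange E c) (by rw [← algebraMap_galConj_finiteAdele', hcδ, map_neg])
    (finiteAdelicForm_eq_map E N T hJ)

/-- `finAdelicToSymplectic g (reIm x) = reIm (g x)` on `(𝔸_E^∞)ᴺ`. [folklore] -/
theorem finAdelicToSymplectic_reIm [Algebra.IsQuadraticExtension F E] {δ : E} (hcδ : c δ = -δ) (hδ : δ ≠ 0) {d : F}
    (hd : δ * δ = algebraMap F E d) {T : Matrix (Fin N) (Fin N) F} (hT : T.IsSymm) {J : Matrix (Fin N) (Fin N) E}
    (hJ : J = T.map (algebraMap F E)) (g : finAdelic F E c N J) (x : Fin N → FiniteAdeleRing (𝓞 E) E) :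
    (finAdelicToSymplectic F E c N hcδ hδ hd hT hJ g).1
        (QuadraticCoordinates.reIm (quadraticFiniteAdeleContinuousEquiv F E c hcδ hδ).toAddEquiv (Fin N) x) =
      QuadraticCoordinates.reIm (quadraticFiniteAdeleContinuousEquiv F E c hcδ hδ).toAddEquiv (Fin N)
        ((g : GL (Fin N) (FiniteAdeleRing (𝓞 E) E)) *ᵥ x) :=
  (isQuadraticCoordinates_finiteAdele E c hcδ hδ hd).toSymplectic_reIm (Fin N) _ _ _ _ g x

/-- `U(J)(𝔸_F^∞) → Sp_{2N}(𝔸_F^∞)` is injective. [folklore] -/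
theorem finAdelicToSymplectic_injective [Algebra.IsQuadraticExtension F E] {δ : E} (hcδ : c δ = -δ) (hδ : δ ≠ 0)
    {d : F} (hd : δ * δ = algebraMap F E d) {T : Matrix (Fin N) (Fin N) F} (hT : T.IsSymm)
    {J : Matrix (Fin N) (Fin N) E} (hJ : J = T.map (algebraMap F E)) :
    Function.Injective (finAdelicToSymplectic F E c N hcδ hδ hd hT hJ) :=
  (isQuadraticCoordinates_finiteAdele E c hcδ hδ hd).toSymplectic_injective (Fin N) _ _ _ _

end FiniteAdele

/-! ## 3b. Adeles: `U(J)(𝔸_F) → Sp_{2N}(𝔸_F)` -/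

section Adele

variable (c : E ≃ₐ[F] E) (N : ℕ)

/-- **The adelic form matrix of `J = T ⊗ 1` is `(T ⊗ 1) ⊗ 1 ∈ M_N(𝔸_E)`**. [folklore] -/
theorem adelicForm_eq_map_map (T : Matrix (Fin N) (Fin N) F) {J : Matrix (Fin N) (Fin N) E}
    (hJ : J = T.map (algebraMap F E)) :
    adelicForm E N J = (T.map (algebraMap F (AdeleRing (𝓞 F) F))).map (AdeleRing.baseChange F E) := by
  rw [adelicForm, hJ, Matrix.map_map, Matrix.map_map]
  congr 1
  funext t
  simp only [Function.comp_apply, AdeleRing.baseChange_algebraMap]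

variable (F)

/-- **`U(J)(𝔸_F) →* Sp(𝔸_Fᴺ × 𝔸_Fᴺ, alt (polar β_T))`** for `J = T ⊗ 1`, `T ∈ Sym_N(F)`: the adelic unitary group
`G(𝐀)` in the adelic symplectic group `Sp_𝐀(W)` of `W = Res_{E/F} Eᴺ`, in the `F`-rational polarisation (uses
`AdeleRing.smul_baseChange`: `Aut(E/F)` fixes `𝔸_F ⊗ 1`). [cite: GelbartRogawski1991, §3.1 p. 454] -/
def adelicToSymplectic [Algebra.IsQuadraticExtension F E] {δ : E} (hcδ : c δ = -δ) (hδ : δ ≠ 0) {d : F}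
    (hd : δ * δ = algebraMap F E d) {T : Matrix (Fin N) (Fin N) F} (hT : T.IsSymm) {J : Matrix (Fin N) (Fin N) E}
    (hJ : J = T.map (algebraMap F E)) :
    adelic F E c N J →*
      symplecticGroup (polar (Matrix.toLinearMap₂' (AdeleRing (𝓞 F) F)
        (T.map (algebraMap F (AdeleRing (𝓞 F) F))))) :=
  (isQuadraticCoordinates_adele E c hcδ hδ hd).toSymplectic (Fin N) (hT.map _) (σ := conjAdele F E c)
    (fun a => by rw [conjAdele_apply, AdeleRing.smul_baseChange])
    (by rw [← algebraMap_conj, RingHom.coe_coe, hcδ, map_neg]) (adelicForm_eq_map_map E N T hJ)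

/-- `adelicToSymplectic g (reIm x) = reIm (g x)` on `𝔸_Eᴺ`. [folklore] -/
theorem adelicToSymplectic_reIm [Algebra.IsQuadraticExtension F E] {δ : E} (hcδ : c δ = -δ) (hδ : δ ≠ 0) {d : F}
    (hd : δ * δ = algebraMap F E d) {T : Matrix (Fin N) (Fin N) F} (hT : T.IsSymm) {J : Matrix (Fin N) (Fin N) E}
    (hJ : J = T.map (algebraMap F E)) (g : adelic F E c N J) (x : Fin N → AdeleRing (𝓞 E) E) :
    (adelicToSymplectic F E c N hcδ hδ hd hT hJ g).1
        (QuadraticCoordinates.reIm (quadraticAdeleEquiv F E c hcδ hδ).toAddEquiv (Fin N) x) =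
      QuadraticCoordinates.reIm (quadraticAdeleEquiv F E c hcδ hδ).toAddEquiv (Fin N)
        ((g : GL (Fin N) (AdeleRing (𝓞 E) E)) *ᵥ x) :=
  (isQuadraticCoordinates_adele E c hcδ hδ hd).toSymplectic_reIm (Fin N) _ _ _ _ g x

/-- `U(J)(𝔸_F) → Sp_{2N}(𝔸_F)` is injective. [folklore] -/
theorem adelicToSymplectic_injective [Algebra.IsQuadraticExtension F E] {δ : E} (hcδ : c δ = -δ) (hδ : δ ≠ 0)
    {d : F} (hd : δ * δ = algebraMap F E d) {T : Matrix (Fin N) (Fin N) F} (hT : T.IsSymm)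
    {J : Matrix (Fin N) (Fin N) E} (hJ : J = T.map (algebraMap F E)) :
    Function.Injective (adelicToSymplectic F E c N hcδ hδ hd hT hJ) :=
  (isQuadraticCoordinates_adele E c hcδ hδ hd).toSymplectic_injective (Fin N) _ _ _ _

end Adele

/-! ## 4. A complex place fixed by `c`: `U(J)(ℝ) = U(σ_w J) → Sp_{2N}(ℝ)` -/

section ArchLocal

/-- **`ℝ × ℝ ≃ ℂ`, `(a, b) ↦ a + b δ'`** for a purely imaginary `δ' ≠ 0` (inverse `z ↦ (re z, im z / im δ')`).
[folklore] -/
def complexCoords (δ' : ℂ) (hre : δ'.re = 0) (him : δ'.im ≠ 0) : (ℝ × ℝ) ≃+ ℂ where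
  toFun p := (p.1 : ℂ) + (p.2 : ℂ) * δ'
  invFun z := (z.re, z.im / δ'.im)
  left_inv p := by
    ext
    · simp [hre]
    · simp [hre, him]
  right_inv z := by
    apply Complex.ext
    · simp [hre]
    · simp [hre, him]
  map_add' p q := by
    simp only [Prod.fst_add, Prod.snd_add, Complex.ofReal_add]
    ring

/-- `complexCoords (a, b) = a + b δ'` (definitional). [folklore] -/
@[simp] theorem complexCoords_apply (δ' : ℂ) (hre : δ'.re = 0) (him : δ'.im ≠ 0) (p : ℝ × ℝ) :
    complexCoords δ' hre him p = (p.1 : ℂ) + (p.2 : ℂ) * δ' := rfl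

/-- **`ℂ = ℝ ⊕ ℝ δ'` as quadratic coordinates** (`φ = ℝ → ℂ`, `d = -(im δ')²`). [folklore] -/
theorem isQuadraticCoordinates_complex (δ' : ℂ) (hre : δ'.re = 0) (him : δ'.im ≠ 0) :
    IsQuadraticCoordinates Complex.ofRealHom (complexCoords δ' hre him) δ' (-(δ'.im ^ 2)) where
  apply a b := rfl
  mul_self := by
    apply Complex.ext
    · simp [hre, sq]
    · simp [hre, sq]

variable (F) (c : E ≃ₐ[F] E) (N : ℕ) (w : {w : InfinitePlace E // InfinitePlace.IsComplex w})

omit [NumberField F] [NumberField E] in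
/-- At a complex place fixed by `c ≠ 1`, `σ_w(F) ⊂ ℝ`: `conj σ_w(t) = σ_w(t)` for `t ∈ F`. [folklore] -/
theorem conj_embedding_algebraMap (hw : c • w.1 = w.1) (hc : c ≠ 1) (t : F) :
    starRingEnd ℂ (w.1.embedding (algebraMap F E t)) = w.1.embedding (algebraMap F E t) := by
  rw [← embedding_galConj F E c w hw hc, AlgEquiv.commutes]

omit [NumberField F] [NumberField E] in
/-- `σ_w(t) = re σ_w(t)` for `t ∈ F`. [folklore] -/
theorem ofReal_re_embedding_algebraMap (hw : c • w.1 = w.1) (hc : c ≠ 1) (t : F) :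
    (((w.1.embedding (algebraMap F E t)).re : ℝ) : ℂ) = w.1.embedding (algebraMap F E t) :=
  Complex.conj_eq_iff_re.mp (conj_embedding_algebraMap F E c w hw hc t)

/-- **The real embedding `F →+* ℝ` under a complex place of `E` fixed by `c ≠ 1`**: `t ↦ re σ_w(t)`. [folklore] -/
def realPlaceMap (hw : c • w.1 = w.1) (hc : c ≠ 1) : F →+* ℝ where
  toFun t := (w.1.embedding (algebraMap F E t)).re
  map_one' := by rw [map_one, map_one, Complex.one_re]
  map_mul' a b := Complex.ofReal_injective (by
    rw [Complex.ofReal_mul, ofReal_re_embedding_algebraMap F E c w hw hc, ofReal_re_embedding_algebraMap F E c w hw hc,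
      ofReal_re_embedding_algebraMap F E c w hw hc, map_mul, map_mul])
  map_zero' := by rw [map_zero, map_zero, Complex.zero_re]
  map_add' a b := by rw [map_add, map_add, Complex.add_re]

/-- `realPlaceMap t = re σ_w(t)` (definitional). [folklore] -/
@[simp] theorem realPlaceMap_apply (hw : c • w.1 = w.1) (hc : c ≠ 1) (t : F) :
    realPlaceMap F E c w hw hc t = (w.1.embedding (algebraMap F E t)).re := rfl

/-- `(realPlaceMap t : ℂ) = σ_w(t)`. [folklore] -/
theorem ofReal_realPlaceMap (hw : c • w.1 = w.1) (hc : c ≠ 1) (t : F) :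
    ((realPlaceMap F E c w hw hc t : ℝ) : ℂ) = w.1.embedding (algebraMap F E t) :=
  ofReal_re_embedding_algebraMap F E c w hw hc t

omit [NumberField F] [NumberField E] in
/-- `conj σ_w(δ) = -σ_w(δ)` when `c δ = -δ`. [folklore] -/
theorem conj_embedding_delta (hw : c • w.1 = w.1) (hc : c ≠ 1) {δ : E} (hcδ : c δ = -δ) :
    starRingEnd ℂ (w.1.embedding δ) = -w.1.embedding δ := by
  rw [← embedding_galConj F E c w hw hc, hcδ, map_neg]

omit [NumberField F] [NumberField E] in
/-- `σ_w(δ)` is purely imaginary. [folklore] -/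
theorem re_embedding_delta (hw : c • w.1 = w.1) (hc : c ≠ 1) {δ : E} (hcδ : c δ = -δ) :
    (w.1.embedding δ).re = 0 := by
  have h := congrArg Complex.re (conj_embedding_delta F E c w hw hc hcδ)
  rw [Complex.conj_re, Complex.neg_re] at h
  linarith

omit [NumberField F] [NumberField E] in
/-- `σ_w(δ) ∉ ℝ`, i.e. `im σ_w(δ) ≠ 0`, when moreover `δ ≠ 0`. [folklore] -/
theorem im_embedding_delta_ne_zero (hw : c • w.1 = w.1) (hc : c ≠ 1) {δ : E} (hcδ : c δ = -δ) (hδ : δ ≠ 0) :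
    (w.1.embedding δ).im ≠ 0 := fun him => by
  apply hδ
  apply (w.1.embedding).injective
  rw [map_zero]
  exact Complex.ext (by rw [re_embedding_delta F E c w hw hc hcδ, Complex.zero_re]) (by rw [him, Complex.zero_im])

/-- **The form matrix at `w` of `J = T ⊗ 1` is `σ_w(T) ⊗ 1 ∈ M_N(ℂ)` with `σ_w(T) ∈ Sym_N(ℝ)`**. [folklore] -/
theorem archLocalForm_eq_map (hw : c • w.1 = w.1) (hc : c ≠ 1) (T : Matrix (Fin N) (Fin N) F)
    {J : Matrix (Fin N) (Fin N) E} (hJ : J = T.map (algebraMap F E)) :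
    J.map w.1.embedding = (T.map (realPlaceMap F E c w hw hc)).map Complex.ofRealHom := by
  rw [hJ, Matrix.map_map, Matrix.map_map]
  congr 1
  funext t
  simp only [Function.comp_apply, Complex.ofRealHom_eq_coe, ofReal_realPlaceMap]

/-- **`U(σ_w J)(ℂ) →* Sp(ℝᴺ × ℝᴺ, alt (polar β_{σ_w T}))`** at a complex place `w` of `E` fixed by `c ≠ 1`, for
`J = T ⊗ 1`, `T ∈ Sym_N(F)`: the real points `U(p, q)` of the unitary group in `Sp_{2N}(ℝ)`, in the polarisation
`ℝᴺ · 1 ⊕ ℝᴺ · σ_w(δ)`. [cite: MoeglinVignerasWaldspurger1987, Ch. 1 I.17] -/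
def archLocalToSymplectic (hw : c • w.1 = w.1) (hc : c ≠ 1) {δ : E} (hcδ : c δ = -δ) (hδ : δ ≠ 0)
    {T : Matrix (Fin N) (Fin N) F} (hT : T.IsSymm) {J : Matrix (Fin N) (Fin N) E} (hJ : J = T.map (algebraMap F E)) :
    archLocal E N J w →* symplecticGroup (polar (Matrix.toLinearMap₂' ℝ (T.map (realPlaceMap F E c w hw hc)))) :=
  (isQuadraticCoordinates_complex (w.1.embedding δ) (re_embedding_delta F E c w hw hc hcδ)
      (im_embedding_delta_ne_zero F E c w hw hc hcδ hδ)).toSymplectic (Fin N) (hT.map _) (σ := starRingEnd ℂ)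
    (fun a => Complex.conj_ofReal a) (conj_embedding_delta F E c w hw hc hcδ)
    (archLocalForm_eq_map F E c N w hw hc T hJ)

/-- `archLocalToSymplectic g (reIm x) = reIm (g x)` on `ℂᴺ`. [folklore] -/
theorem archLocalToSymplectic_reIm (hw : c • w.1 = w.1) (hc : c ≠ 1) {δ : E} (hcδ : c δ = -δ) (hδ : δ ≠ 0)
    {T : Matrix (Fin N) (Fin N) F} (hT : T.IsSymm) {J : Matrix (Fin N) (Fin N) E} (hJ : J = T.map (algebraMap F E))
    (g : archLocal E N J w) (x : Fin N → ℂ) :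
    (archLocalToSymplectic F E c N w hw hc hcδ hδ hT hJ g).1
        (QuadraticCoordinates.reIm (complexCoords (w.1.embedding δ) (re_embedding_delta F E c w hw hc hcδ)
          (im_embedding_delta_ne_zero F E c w hw hc hcδ hδ)) (Fin N) x) =
      QuadraticCoordinates.reIm (complexCoords (w.1.embedding δ) (re_embedding_delta F E c w hw hc hcδ)
          (im_embedding_delta_ne_zero F E c w hw hc hcδ hδ)) (Fin N) ((g : GL (Fin N) ℂ) *ᵥ x) :=
  IsQuadraticCoordinates.toSymplectic_reIm _ (Fin N) _ _ _ _ g x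

/-- `U(σ_w J)(ℂ) → Sp_{2N}(ℝ)` is injective. [folklore] -/
theorem archLocalToSymplectic_injective (hw : c • w.1 = w.1) (hc : c ≠ 1) {δ : E} (hcδ : c δ = -δ) (hδ : δ ≠ 0)
    {T : Matrix (Fin N) (Fin N) F} (hT : T.IsSymm) {J : Matrix (Fin N) (Fin N) E}
    (hJ : J = T.map (algebraMap F E)) :
    Function.Injective (archLocalToSymplectic F E c N w hw hc hcδ hδ hT hJ) :=
  IsQuadraticCoordinates.toSymplectic_injective _ (Fin N) _ _ _ _

end ArchLocal

/-! ## 5. The dual pair `U(J_V) × U(J_W) → Sp` at each level -/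

section DualPairs

variable (F) (c : E ≃ₐ[F] E) (N M : ℕ)

/-- **`U(J_V)(F) × U(J_W)(F) →* Sp(F^{N M} × F^{N M}, alt (polar β_{T_V ⊗ T_W}))`**, `(g, g') ↦ Res (g ⊗ g')`.
[cite: GelbartRogawski1991, §3.1 p. 454] -/
def rationalDualPairToSymplectic [Algebra.IsQuadraticExtension F E] {δ : E} (hcδ : c δ = -δ) (hδ : δ ≠ 0) {d : F}
    (hd : δ * δ = algebraMap F E d) {TV : Matrix (Fin N) (Fin N) F} {TW : Matrix (Fin M) (Fin M) F}
    (hV : TV.IsSymm) (hW : TW.IsSymm) {JV : Matrix (Fin N) (Fin N) E} {JW : Matrix (Fin M) (Fin M) E}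
    (hJV : JV = TV.map (algebraMap F E)) (hJW : JW = TW.map (algebraMap F E)) :
    rational F E c N JV × rational F E c M JW →* symplecticGroup (polar (Matrix.toLinearMap₂' F (TV ⊗ₖ TW))) :=
  (isQuadraticCoordinates_rat E c hcδ hδ hd).dualPairToSymplectic hV hW (σ := (c : E →+* E))
    (fun a => c.commutes a) hcδ hJV hJW

/-- **`U(J_V)(F_v) × U(J_W)(F_v) →* Sp_{2NM}(F_v)`** (`v` finite). [cite: MoeglinVignerasWaldspurger1987, Ch. 1 I.17] -/
def localDualPairToSymplectic [Algebra.IsQuadraticExtension F E] (v : HeightOneSpectrum (𝓞 F)) {δ : E}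
    (hcδ : c δ = -δ) (hδ : δ ≠ 0) {d : F} (hd : δ * δ = algebraMap F E d) {TV : Matrix (Fin N) (Fin N) F}
    {TW : Matrix (Fin M) (Fin M) F} (hV : TV.IsSymm) (hW : TW.IsSymm) {JV : Matrix (Fin N) (Fin N) E}
    {JW : Matrix (Fin M) (Fin M) E} (hJV : JV = TV.map (algebraMap F E)) (hJW : JW = TW.map (algebraMap F E)) :
    «local» E c N JV v × «local» E c M JW v →*
      symplecticGroup (polar (Matrix.toLinearMap₂' (v.adicCompletion F)
        (TV.map (algebraMap F (v.adicCompletion F)) ⊗ₖ TW.map (algebraMap F (v.adicCompletion F))))) :=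
  (isQuadraticCoordinates_local E v c hcδ hδ hd).dualPairToSymplectic (hV.map _) (hW.map _) (σ := conjLocal E c v)
    (conjLocal_toLocalRing c v) (by rw [conjLocal_algebraMap, hcδ, map_neg]) (localForm_eq_map E N v TV hJV)
    (localForm_eq_map E M v TW hJW)

/-- **`U(J_V)(𝔸_F^∞) × U(J_W)(𝔸_F^∞) →* Sp_{2NM}(𝔸_F^∞)`**. [cite: GelbartRogawski1991, §3.1 p. 454] -/
def finAdelicDualPairToSymplectic [Algebra.IsQuadraticExtension F E] {δ : E} (hcδ : c δ = -δ) (hδ : δ ≠ 0) {d : F}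
    (hd : δ * δ = algebraMap F E d) {TV : Matrix (Fin N) (Fin N) F} {TW : Matrix (Fin M) (Fin M) F}
    (hV : TV.IsSymm) (hW : TW.IsSymm) {JV : Matrix (Fin N) (Fin N) E} {JW : Matrix (Fin M) (Fin M) E}
    (hJV : JV = TV.map (algebraMap F E)) (hJW : JW = TW.map (algebraMap F E)) :
    finAdelic F E c N JV × finAdelic F E c M JW →*
      symplecticGroup (polar (Matrix.toLinearMap₂' (FiniteAdeleRing (𝓞 F) F)
        (TV.map (algebraMap F (FiniteAdeleRing (𝓞 F) F)) ⊗ₖ TW.map (algebraMap F (FiniteAdeleRing (𝓞 F) F))))) :=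
  (isQuadraticCoordinates_finiteAdele E c hcδ hδ hd).dualPairToSymplectic (hV.map _) (hW.map _)
    (σ := conjFiniteAdele F E c) (conjFiniteAdele_baseChange E c)
    (by rw [← algebraMap_galConj_finiteAdele', hcδ, map_neg]) (finiteAdelicForm_eq_map E N TV hJV)
    (finiteAdelicForm_eq_map E M TW hJW)

/-- **`U(J_V)(𝔸_F) × U(J_W)(𝔸_F) →* Sp_{2NM}(𝔸_F)`**: `G(𝐀) × G′(𝐀) → Sp_𝐀(𝕎)`.
[cite: GelbartRogawski1991, §3.1 p. 454] -/
def adelicDualPairToSymplectic [Algebra.IsQuadraticExtension F E] {δ : E} (hcδ : c δ = -δ) (hδ : δ ≠ 0) {d : F}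
    (hd : δ * δ = algebraMap F E d) {TV : Matrix (Fin N) (Fin N) F} {TW : Matrix (Fin M) (Fin M) F}
    (hV : TV.IsSymm) (hW : TW.IsSymm) {JV : Matrix (Fin N) (Fin N) E} {JW : Matrix (Fin M) (Fin M) E}
    (hJV : JV = TV.map (algebraMap F E)) (hJW : JW = TW.map (algebraMap F E)) :
    adelic F E c N JV × adelic F E c M JW →*
      symplecticGroup (polar (Matrix.toLinearMap₂' (AdeleRing (𝓞 F) F)
        (TV.map (algebraMap F (AdeleRing (𝓞 F) F)) ⊗ₖ TW.map (algebraMap F (AdeleRing (𝓞 F) F))))) :=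
  (isQuadraticCoordinates_adele E c hcδ hδ hd).dualPairToSymplectic (hV.map _) (hW.map _)
    (σ := conjAdele F E c) (fun a => by rw [conjAdele_apply, AdeleRing.smul_baseChange])
    (by rw [← algebraMap_conj, RingHom.coe_coe, hcδ, map_neg]) (adelicForm_eq_map_map E N TV hJV)
    (adelicForm_eq_map_map E M TW hJW)

/-- **`U(σ_w J_V)(ℂ) × U(σ_w J_W)(ℂ) →* Sp_{2NM}(ℝ)`** at a complex place fixed by `c ≠ 1` (for `M = 1`:
`U(p, q) × U(1) → Sp_{2N}(ℝ)`). [cite: MoeglinVignerasWaldspurger1987, Ch. 1 I.17] -/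
def archLocalDualPairToSymplectic (w : {w : InfinitePlace E // InfinitePlace.IsComplex w}) (hw : c • w.1 = w.1)
    (hc : c ≠ 1) {δ : E} (hcδ : c δ = -δ) (hδ : δ ≠ 0) {TV : Matrix (Fin N) (Fin N) F}
    {TW : Matrix (Fin M) (Fin M) F} (hV : TV.IsSymm) (hW : TW.IsSymm) {JV : Matrix (Fin N) (Fin N) E}
    {JW : Matrix (Fin M) (Fin M) E} (hJV : JV = TV.map (algebraMap F E)) (hJW : JW = TW.map (algebraMap F E)) :
    archLocal E N JV w × archLocal E M JW w →*
      symplecticGroup (polar (Matrix.toLinearMap₂' ℝ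
        (TV.map (realPlaceMap F E c w hw hc) ⊗ₖ TW.map (realPlaceMap F E c w hw hc)))) :=
  (isQuadraticCoordinates_complex (w.1.embedding δ) (re_embedding_delta F E c w hw hc hcδ)
      (im_embedding_delta_ne_zero F E c w hw hc hcδ hδ)).dualPairToSymplectic (hV.map _) (hW.map _)
    (σ := starRingEnd ℂ) (fun a => Complex.conj_ofReal a) (conj_embedding_delta F E c w hw hc hcδ)
    (archLocalForm_eq_map F E c N w hw hc TV hJV) (archLocalForm_eq_map F E c M w hw hc TW hJW)

end DualPairs

/-! ## 6. Rational points go to rational points: `ι_𝔸 ∘ (F ↪ 𝔸) = (F ↪ 𝔸) ∘ ι_F` entrywise -/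

section RationalPoints

variable (F) (c : E ≃ₐ[F] E) (N : ℕ)

/-- **`re_𝔸 (e ⊗ 1) = (re_F e) ⊗ 1`**: the adelic coordinates extend the rational ones. [folklore] -/
theorem adele_re_algebraMap [Algebra.IsQuadraticExtension F E] {δ : E} (hcδ : c δ = -δ) (hδ : δ ≠ 0) {d : F}
    (hd : δ * δ = algebraMap F E d) (e : E) :
    QuadraticCoordinates.re (quadraticAdeleEquiv F E c hcδ hδ).toAddEquiv (algebraMap E (AdeleRing (𝓞 E) E) e) =
      algebraMap F (AdeleRing (𝓞 F) F)
        (QuadraticCoordinates.re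
          (quadraticRatCoords E (not_mem_range_algebraMap_of_apply_eq_neg E c hcδ hδ)).toAddEquiv e) := by
  conv_lhs => rw [← (isQuadraticCoordinates_rat E c hcδ hδ hd).re_add_im e]
  rw [map_add, map_mul, ← AdeleRing.baseChange_algebraMap, ← AdeleRing.baseChange_algebraMap,
    (isQuadraticCoordinates_adele E c hcδ hδ hd).re_eq]

/-- **`im_𝔸 (e ⊗ 1) = (im_F e) ⊗ 1`**. [folklore] -/
theorem adele_im_algebraMap [Algebra.IsQuadraticExtension F E] {δ : E} (hcδ : c δ = -δ) (hδ : δ ≠ 0) {d : F}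
    (hd : δ * δ = algebraMap F E d) (e : E) :
    QuadraticCoordinates.im (quadraticAdeleEquiv F E c hcδ hδ).toAddEquiv (algebraMap E (AdeleRing (𝓞 E) E) e) =
      algebraMap F (AdeleRing (𝓞 F) F)
        (QuadraticCoordinates.im
          (quadraticRatCoords E (not_mem_range_algebraMap_of_apply_eq_neg E c hcδ hδ)).toAddEquiv e) := by
  conv_lhs => rw [← (isQuadraticCoordinates_rat E c hcδ hδ hd).re_add_im e]
  rw [map_add, map_mul, ← AdeleRing.baseChange_algebraMap, ← AdeleRing.baseChange_algebraMap,
    (isQuadraticCoordinates_adele E c hcδ hδ hd).im_eq]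

/-- **`ι_𝔸(γ)` has `F`-rational blocks for `γ ∈ U(J)(F)`**: with `γ = γ₁ + γ₂ δ` (`γ₁ = re ∘ γ`, `γ₂ = im ∘ γ`
entrywise over `F`), `adelicToSymplectic (toAdelic γ) (a, b) = ((γ₁ ⊗ 1) a + d (γ₂ ⊗ 1) b, (γ₂ ⊗ 1) a + (γ₁ ⊗ 1) b)` —
so `ι_𝔸(G(F)) ⊂ Sp_F(W)` (the rational points of the adelic symplectic group). [cite: GelbartRogawski1991, §3.1 p. 455] -/
theorem adelicToSymplectic_toAdelic_apply [Algebra.IsQuadraticExtension F E] {δ : E} (hcδ : c δ = -δ) (hδ : δ ≠ 0)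
    {d : F} (hd : δ * δ = algebraMap F E d) {T : Matrix (Fin N) (Fin N) F} (hT : T.IsSymm)
    {J : Matrix (Fin N) (Fin N) E} (hJ : J = T.map (algebraMap F E)) (γ : rational F E c N J)
    (a b : Fin N → AdeleRing (𝓞 F) F) :
    (adelicToSymplectic F E c N hcδ hδ hd hT hJ (toAdelic F E c N J γ)).1 (a, b) =
      ((((γ : GL (Fin N) E) : Matrix (Fin N) (Fin N) E).map (QuadraticCoordinates.re
            (quadraticRatCoords E (not_mem_range_algebraMap_of_apply_eq_neg E c hcδ hδ)).toAddEquiv)).map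
            (algebraMap F (AdeleRing (𝓞 F) F)) *ᵥ a +
          algebraMap F (AdeleRing (𝓞 F) F) d •
            ((((γ : GL (Fin N) E) : Matrix (Fin N) (Fin N) E).map (QuadraticCoordinates.im
              (quadraticRatCoords E (not_mem_range_algebraMap_of_apply_eq_neg E c hcδ hδ)).toAddEquiv)).map
              (algebraMap F (AdeleRing (𝓞 F) F)) *ᵥ b),
        (((γ : GL (Fin N) E) : Matrix (Fin N) (Fin N) E).map (QuadraticCoordinates.im
            (quadraticRatCoords E (not_mem_range_algebraMap_of_apply_eq_neg E c hcδ hδ)).toAddEquiv)).map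
            (algebraMap F (AdeleRing (𝓞 F) F)) *ᵥ a +
          (((γ : GL (Fin N) E) : Matrix (Fin N) (Fin N) E).map (QuadraticCoordinates.re
            (quadraticRatCoords E (not_mem_range_algebraMap_of_apply_eq_neg E c hcδ hδ)).toAddEquiv)).map
            (algebraMap F (AdeleRing (𝓞 F) F)) *ᵥ b) := by
  have hre : ∀ M : Matrix (Fin N) (Fin N) E,
      (M.map (algebraMap E (AdeleRing (𝓞 E) E))).map
          (QuadraticCoordinates.re (quadraticAdeleEquiv F E c hcδ hδ).toAddEquiv) =
        (M.map (QuadraticCoordinates.re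
          (quadraticRatCoords E (not_mem_range_algebraMap_of_apply_eq_neg E c hcδ hδ)).toAddEquiv)).map
          (algebraMap F (AdeleRing (𝓞 F) F)) := fun M => by
    rw [Matrix.map_map, Matrix.map_map]
    exact congrArg M.map (funext (adele_re_algebraMap F E c hcδ hδ hd))
  have him : ∀ M : Matrix (Fin N) (Fin N) E,
      (M.map (algebraMap E (AdeleRing (𝓞 E) E))).map
          (QuadraticCoordinates.im (quadraticAdeleEquiv F E c hcδ hδ).toAddEquiv) =
        (M.map (QuadraticCoordinates.im
          (quadraticRatCoords E (not_mem_range_algebraMap_of_apply_eq_neg E c hcδ hδ)).toAddEquiv)).map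
          (algebraMap F (AdeleRing (𝓞 F) F)) := fun M => by
    rw [Matrix.map_map, Matrix.map_map]
    exact congrArg M.map (funext (adele_im_algebraMap F E c hcδ hδ hd))
  rw [← hre, ← him]
  exact (isQuadraticCoordinates_adele E c hcδ hδ hd).resAut_apply_mk (Fin N) _ a b

/-- **`re_{𝔸^∞} (e ⊗ 1) = (re_F e) ⊗ 1`**. [folklore] -/
theorem finiteAdele_re_algebraMap [Algebra.IsQuadraticExtension F E] {δ : E} (hcδ : c δ = -δ) (hδ : δ ≠ 0) {d : F}
    (hd : δ * δ = algebraMap F E d) (e : E) :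
    QuadraticCoordinates.re (quadraticFiniteAdeleContinuousEquiv F E c hcδ hδ).toAddEquiv
        (algebraMap E (FiniteAdeleRing (𝓞 E) E) e) =
      algebraMap F (FiniteAdeleRing (𝓞 F) F)
        (QuadraticCoordinates.re
          (quadraticRatCoords E (not_mem_range_algebraMap_of_apply_eq_neg E c hcδ hδ)).toAddEquiv e) := by
  conv_lhs => rw [← (isQuadraticCoordinates_rat E c hcδ hδ hd).re_add_im e]
  rw [map_add, map_mul, ← FiniteAdeleRing.baseChange_algebraMap (𝓞 F) F E (𝓞 E),
    ← FiniteAdeleRing.baseChange_algebraMap (𝓞 F) F E (𝓞 E), (isQuadraticCoordinates_finiteAdele E c hcδ hδ hd).re_eq]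

/-- **`im_{𝔸^∞} (e ⊗ 1) = (im_F e) ⊗ 1`**. [folklore] -/
theorem finiteAdele_im_algebraMap [Algebra.IsQuadraticExtension F E] {δ : E} (hcδ : c δ = -δ) (hδ : δ ≠ 0) {d : F}
    (hd : δ * δ = algebraMap F E d) (e : E) :
    QuadraticCoordinates.im (quadraticFiniteAdeleContinuousEquiv F E c hcδ hδ).toAddEquiv
        (algebraMap E (FiniteAdeleRing (𝓞 E) E) e) =
      algebraMap F (FiniteAdeleRing (𝓞 F) F)
        (QuadraticCoordinates.im
          (quadraticRatCoords E (not_mem_range_algebraMap_of_apply_eq_neg E c hcδ hδ)).toAddEquiv e) := by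
  conv_lhs => rw [← (isQuadraticCoordinates_rat E c hcδ hδ hd).re_add_im e]
  rw [map_add, map_mul, ← FiniteAdeleRing.baseChange_algebraMap (𝓞 F) F E (𝓞 E),
    ← FiniteAdeleRing.baseChange_algebraMap (𝓞 F) F E (𝓞 E), (isQuadraticCoordinates_finiteAdele E c hcδ hδ hd).im_eq]

end RationalPoints

/-! ## 7. Darboux transport to the dot pairing: `Sp(alt (polar β_T)) →* Sp(alt (polar β_dot))`

The archimedean consumer (`Weil1964/ArchWeilDatum.lean`, `SpR σ = symplecticGroup (polar (dotPairing σ))`,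
`dotPairing σ = dotProductBilin ℝ ℝ`) works in DARBOUX coordinates: `θ_T (a, b) = (a, T b)` carries `polar β_T` to
`polar β_dot` (`β_T(a, b′) = a · (T b′)`), so conjugation by `θ_T` (for `det T` a unit) moves every embedding above into
`Sp(Rⁿ × Rⁿ, alt (polar β_dot))`. -/

section Darboux

variable {R : Type*} [CommRing R] {V V' : Type*} [AddCommGroup V] [Module R V] [AddCommGroup V'] [Module R V']

/-- **Transport of structure**: an `R`-linear isomorphism `θ` with `B′(θv, θw) = B(v, w)` conjugates `Sp(alt B)`
into `Sp(alt B′)`, `g ↦ θ g θ⁻¹`. [folklore] -/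
def symplecticGroupCongr (B : V →ₗ[R] V →ₗ[R] R) (B' : V' →ₗ[R] V' →ₗ[R] R) (θ : V ≃ₗ[R] V')
    (hθ : ∀ v w, B' (θ v) (θ w) = B v w) : symplecticGroup B →* symplecticGroup B' where
  toFun g := ⟨(θ.symm.trans (g : V ≃ₗ[R] V)).trans θ, by
    rw [mem_symplecticGroup]
    intro v w
    have hg := (mem_symplecticGroup B (g : V ≃ₗ[R] V)).1 g.2 (θ.symm v) (θ.symm w)
    simp only [LinearEquiv.trans_apply]
    rw [hθ, hθ, hg, ← hθ (θ.symm v) (θ.symm w), ← hθ (θ.symm w) (θ.symm v), LinearEquiv.apply_symm_apply,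
      LinearEquiv.apply_symm_apply]⟩
  map_one' := Subtype.ext (LinearEquiv.ext fun v => by simp)
  map_mul' g g' := Subtype.ext (LinearEquiv.ext fun v => by simp [LinearEquiv.mul_apply])

/-- formula: `symplecticGroupCongr θ g = θ ∘ g ∘ θ⁻¹`. [folklore] -/
@[simp] theorem coe_symplecticGroupCongr_apply (B : V →ₗ[R] V →ₗ[R] R) (B' : V' →ₗ[R] V' →ₗ[R] R) (θ : V ≃ₗ[R] V')
    (hθ : ∀ v w, B' (θ v) (θ w) = B v w) (g : symplecticGroup B) (v : V') :
    ((symplecticGroupCongr B B' θ hθ g : symplecticGroup B') : V' ≃ₗ[R] V') v = θ ((g : V ≃ₗ[R] V) (θ.symm v)) :=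
  rfl

/-- `symplecticGroupCongr θ` is injective. [folklore] -/
theorem symplecticGroupCongr_injective (B : V →ₗ[R] V →ₗ[R] R) (B' : V' →ₗ[R] V' →ₗ[R] R) (θ : V ≃ₗ[R] V')
    (hθ : ∀ v w, B' (θ v) (θ w) = B v w) : Function.Injective (symplecticGroupCongr B B' θ hθ) := by
  intro g g' hgg'
  refine Subtype.ext (LinearEquiv.ext fun v => ?_)
  have := congrArg (fun k : symplecticGroup B' => θ.symm ((k : V' ≃ₗ[R] V') (θ v))) hgg'
  simpa using this

variable {n : Type*} [Fintype n] [DecidableEq n]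

/-- **The Darboux change of coordinates** `θ_T (a, b) = (a, T b)` (inverse `(a, b) ↦ (a, T⁻¹ b)`), for `det T` a unit.
[folklore] -/
def darboux (T : Matrix n n R) (hT : IsUnit T.det) : ((n → R) × (n → R)) ≃ₗ[R] ((n → R) × (n → R)) where
  toFun p := (p.1, T *ᵥ p.2)
  invFun p := (p.1, T⁻¹ *ᵥ p.2)
  map_add' p q := Prod.ext rfl (Matrix.mulVec_add T p.2 q.2)
  map_smul' a p := Prod.ext rfl (Matrix.mulVec_smul T a p.2)
  left_inv p := Prod.ext rfl (by
    show T⁻¹ *ᵥ (T *ᵥ p.2) = p.2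
    rw [Matrix.mulVec_mulVec, Matrix.nonsing_inv_mul T hT, Matrix.one_mulVec])
  right_inv p := Prod.ext rfl (by
    show T *ᵥ (T⁻¹ *ᵥ p.2) = p.2
    rw [Matrix.mulVec_mulVec, Matrix.mul_nonsing_inv T hT, Matrix.one_mulVec])

/-- formula. [folklore] -/
@[simp] theorem darboux_apply (T : Matrix n n R) (hT : IsUnit T.det) (p : (n → R) × (n → R)) :
    darboux T hT p = (p.1, T *ᵥ p.2) := rfl

/-- formula for the inverse. [folklore] -/
@[simp] theorem darboux_symm_apply (T : Matrix n n R) (hT : IsUnit T.det) (p : (n → R) × (n → R)) :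
    (darboux T hT).symm p = (p.1, T⁻¹ *ᵥ p.2) := rfl

/-- **`θ_T` carries `polar β_T` to `polar β_dot`**: `(θ_T p).1 · (θ_T q).2 = p.1 · (T q.2) = β_T(p.1, q.2)`. [folklore] -/
theorem polar_dot_darboux (T : Matrix n n R) (hT : IsUnit T.det) (p q : (n → R) × (n → R)) :
    polar (dotProductBilin R R : (n → R) →ₗ[R] (n → R) →ₗ[R] R) (darboux T hT p) (darboux T hT q) =
      polar (Matrix.toLinearMap₂' R T) p q := by
  rw [polar_apply, polar_apply, darboux_apply, darboux_apply, dotProductBilin_apply_apply, Matrix.toLinearMap₂'_apply']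

/-- `det (T ⊗ 1)` is a unit when `det T` is. [folklore] -/
theorem isUnit_det_map {S : Type*} [CommRing S] (f : R →+* S) {T : Matrix n n R} (hT : IsUnit T.det) :
    IsUnit (T.map f).det := by
  rw [show T.map f = f.mapMatrix T from rfl, ← RingHom.map_det]
  exact hT.map f

end Darboux

section DarbouxEmbedding

namespace IsQuadraticCoordinates

variable {R S : Type*} [CommRing R] [CommRing S] {φ : R →+* S} {Ψ : (R × R) ≃+ S} {δ : S} {d : R}

/-- **`U(σ, H) →* Sp(Rⁿ × Rⁿ, alt (polar β_dot))`** (`H = T ⊗ 1`, `Tᵀ = T`, `det T` a unit): the embedding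
`toSymplectic` read in the Darboux coordinates `(re x, T · im x)`. [cite: GelbartRogawski1991, §3.1 p. 454] -/
def toSymplecticDot
    (h : IsQuadraticCoordinates φ Ψ δ d) (n : Type*) [Fintype n] [DecidableEq n] {T : Matrix n n R}
    (hT : T.IsSymm) (hTd : IsUnit T.det) {σ : S →+* S} (hσφ : ∀ a, σ (φ a) = φ a) (hσδ : σ δ = -δ)
    {H : Matrix n n S} (hH : H = T.map φ) :
    unitaryGroupOfForm σ H →* symplecticGroup (polar (dotProductBilin R R : (n → R) →ₗ[R] (n → R) →ₗ[R] R)) :=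
  (symplecticGroupCongr _ _ (darboux T hTd) (polar_dot_darboux T hTd)).comp (h.toSymplectic n hT hσφ hσδ hH)

/-- formula: `toSymplecticDot g (a, T b) = (re (g x), T im (g x))` for `x = a + b δ`. [folklore] -/
theorem toSymplecticDot_apply
    (h : IsQuadraticCoordinates φ Ψ δ d) (n : Type*) [Fintype n] [DecidableEq n] {T : Matrix n n R}
    (hT : T.IsSymm) (hTd : IsUnit T.det) {σ : S →+* S} (hσφ : ∀ a, σ (φ a) = φ a) (hσδ : σ δ = -δ)
    {H : Matrix n n S} (hH : H = T.map φ) (g : unitaryGroupOfForm σ H) (p : (n → R) × (n → R)) :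
    (h.toSymplecticDot n hT hTd hσφ hσδ hH g).1 p =
      darboux T hTd ((h.toSymplectic n hT hσφ hσδ hH g).1 ((darboux T hTd).symm p)) :=
  rfl

/-- `toSymplecticDot` on Darboux images of coordinates: `θ_T (re x, im x) ↦ θ_T (re (g x), im (g x))`. [folklore] -/
theorem toSymplecticDot_darboux_reIm
    (h : IsQuadraticCoordinates φ Ψ δ d) (n : Type*) [Fintype n] [DecidableEq n] {T : Matrix n n R}
    (hT : T.IsSymm) (hTd : IsUnit T.det) {σ : S →+* S} (hσφ : ∀ a, σ (φ a) = φ a) (hσδ : σ δ = -δ)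
    {H : Matrix n n S} (hH : H = T.map φ) (g : unitaryGroupOfForm σ H) (x : n → S) :
    (h.toSymplecticDot n hT hTd hσφ hσδ hH g).1 (darboux T hTd (QuadraticCoordinates.reIm Ψ n x)) =
      darboux T hTd (QuadraticCoordinates.reIm Ψ n (((g : GL n S) : Matrix n n S) *ᵥ x)) := by
  rw [h.toSymplecticDot_apply, LinearEquiv.symm_apply_apply, h.toSymplectic_reIm]

/-- `toSymplecticDot` is injective. [folklore] -/
theorem toSymplecticDot_injective
    (h : IsQuadraticCoordinates φ Ψ δ d) (n : Type*) [Fintype n] [DecidableEq n] {T : Matrix n n R}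
    (hT : T.IsSymm) (hTd : IsUnit T.det) {σ : S →+* S} (hσφ : ∀ a, σ (φ a) = φ a) (hσδ : σ δ = -δ)
    {H : Matrix n n S} (hH : H = T.map φ) : Function.Injective (h.toSymplecticDot n hT hTd hσφ hσδ hH) :=
  (symplecticGroupCongr_injective _ _ (darboux T hTd) (polar_dot_darboux T hTd)).comp
    (h.toSymplectic_injective n hT hσφ hσδ hH)

end IsQuadraticCoordinates

end DarbouxEmbedding

section ArchDarboux

variable (F) (c : E ≃ₐ[F] E) (N : ℕ) (w : {w : InfinitePlace E // InfinitePlace.IsComplex w})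

/-- **`ι_𝕎 : U(J)(E_w) →* Sp(ℝ^N × ℝ^N, alt (polar β_dot))`** — the archimedean embedding in the Darboux coordinates of
`Weil1964/ArchWeilDatum.lean` (`SpR (Fin N)`), for `J = T ⊗ 1` with `Tᵀ = T`, `det T ≠ 0`.
[cite: GelbartRogawski1991, §3.1 p. 454] -/
def archLocalToSymplecticDot (hw : c • w.1 = w.1) (hc : c ≠ 1) {δ : E} (hcδ : c δ = -δ) (hδ : δ ≠ 0)
    {T : Matrix (Fin N) (Fin N) F} (hT : T.IsSymm) (hTd : IsUnit T.det)
    {J : Matrix (Fin N) (Fin N) E} (hJ : J = T.map (algebraMap F E)) :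
    archLocal E N J w →*
      symplecticGroup (polar (dotProductBilin ℝ ℝ : (Fin N → ℝ) →ₗ[ℝ] (Fin N → ℝ) →ₗ[ℝ] ℝ)) :=
  (symplecticGroupCongr _ _ (darboux (T.map (realPlaceMap F E c w hw hc)) (isUnit_det_map _ hTd))
      (polar_dot_darboux _ _)).comp (archLocalToSymplectic F E c N w hw hc hcδ hδ hT hJ)

/-- formula: `archLocalToSymplecticDot g = θ ∘ archLocalToSymplectic g ∘ θ⁻¹`, `θ = darboux (T ⊗_F ℝ)`. [folklore] -/
theorem archLocalToSymplecticDot_apply (hw : c • w.1 = w.1) (hc : c ≠ 1) {δ : E} (hcδ : c δ = -δ) (hδ : δ ≠ 0)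
    {T : Matrix (Fin N) (Fin N) F} (hT : T.IsSymm) (hTd : IsUnit T.det)
    {J : Matrix (Fin N) (Fin N) E} (hJ : J = T.map (algebraMap F E)) (g : archLocal E N J w)
    (p : (Fin N → ℝ) × (Fin N → ℝ)) :
    (archLocalToSymplecticDot F E c N w hw hc hcδ hδ hT hTd hJ g).1 p =
      darboux (T.map (realPlaceMap F E c w hw hc)) (isUnit_det_map _ hTd)
        ((archLocalToSymplectic F E c N w hw hc hcδ hδ hT hJ g).1
          ((darboux (T.map (realPlaceMap F E c w hw hc)) (isUnit_det_map _ hTd)).symm p)) :=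
  rfl

/-- `archLocalToSymplecticDot` is injective. [folklore] -/
theorem archLocalToSymplecticDot_injective (hw : c • w.1 = w.1) (hc : c ≠ 1) {δ : E} (hcδ : c δ = -δ) (hδ : δ ≠ 0)
    {T : Matrix (Fin N) (Fin N) F} (hT : T.IsSymm) (hTd : IsUnit T.det)
    {J : Matrix (Fin N) (Fin N) E} (hJ : J = T.map (algebraMap F E)) :
    Function.Injective (archLocalToSymplecticDot F E c N w hw hc hcδ hδ hT hTd hJ) :=
  (symplecticGroupCongr_injective _ _ (darboux (T.map (realPlaceMap F E c w hw hc)) (isUnit_det_map _ hTd))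
      (polar_dot_darboux _ _)).comp (archLocalToSymplectic_injective F E c N w hw hc hcδ hδ hT hJ)

end ArchDarboux

end UnitaryGroup

end Literature.NumberTheory.Automorphic

end
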